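import Literature.MathematicalPhysics.QuantumFieldTheory.Balaban1983to89.B9DirSupHolderAtPins
import Literature.MathematicalPhysics.QuantumFieldTheory.Balaban1983to89.Node00.OpsYDirTranspose
import Literature.MathematicalPhysics.QuantumFieldTheory.Balaban1983to89.B9CoReadingCoordsHolderSAdm
import Literature.MathematicalPhysics.QuantumFieldTheory.Balaban1983to89.B9CoReadingCoordsHolderAdm
import Literature.MathematicalPhysics.QuantumFieldTheory.Balaban1983to89.B9DirSupSqAtPinsA
import Summits.QuantumFields.YangMills.Theorems.BalabanUVNodesN06DirKinematicsAtPins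
import Literature.MathematicalPhysics.QuantumFieldTheory.Balaban1983to89.B9OpsRTransport

/-!
# BalabanUVNodes ∕ N06 ([B9], `Dag.B9_main`) — CASCADE-R STEP 3: THE R-GENERIC TWINS of `N06DirKinematicsAtPins` (the kinematic conjuncts of rows 18–19's `h36 ∕ h36A ∕ h36HA`
# at the pins: `h36HA_of_dir_pinsR`, `h36_of_dirSq_pinsR`, `h36A_of_dirSq_pinsR`), re-typed over the CLASS-PARAMETRIC member background `bg9YR 𝔸 G R₁ R₂` (objects AND premises)

Track A of `YM-PLAN.md` (cell `pub-ymgap`, D-0062), node **N06** = [Balaban1985BackgroundPropagators] Thms 3.1–3.15; seat `pub-ymgap-dag-n06-d` (gen 13).  WHY: node00-def-Y g23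
RULING-2 (I.39588), road (α1); census I.39391 marks `h36H(A)_of_dir_pins ∕ h36A_of_dirSq_pins` «`bg9Y`-PINNED ✗, c-GENERIC».  The kinematic Y-faces they call — node00-def-Y's
`dirTranspose310_memberY` (reads the (3.35) class), this seat's `dirSupHolder310_pinsKA`, dag-n06-w5's `dirSup310_pins ∕ dirSupSq37_pins ∕ dirSupSq310_pins` (class-free) — are
Ops-TYPED; they are consumed UNCHANGED at node00-def-Y's fieldwise re-typings `opsRY ∕ ops310RY ∕ dirOps37RY ∕ dirOps310RY ∕ holderProbesRY` (`B9OpsRTransport`, p648903; dag-n06-w7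
OFFER-1 road (B)), their outputs carried back by `dirTranspose310_iff ∕ dirSupHolder310_iff ∕ dirSup310_iff ∕ dirSupSq37_iff ∕ dirSupSq310_iff`; per RULING-2 (c) the (3.35) read
of the transpose face is ONE displayed hypothesis `hY335` (Y-closer `id`; P-closer dag-n06-j's bridge at `c := c35B ℓ`).  (`h36H_of_dir_pins₃R` is in `…DirKinematics3AtPinsR`.)
HONEST FRAMING.  Mechanical re-typing + transport; kinematics only (no estimate of [B9]); COUNT-NEUTRAL; N06 NOT discharged; K1⁹ NOT closed; one finite 𝕋⁴ programme at fixed `ε` —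
NOT continuum ∕ OS ∕ mass gap ∕ Clay.  0 `def`, 0 `sorry`.
-/

noncomputable section

namespace Summit.QuantumFields.YangMills.BalabanUVNodes.N06DirKinematicsAtPinsR

open Literature.MathematicalPhysics.QuantumFieldTheory.Balaban1983to89
open Literature.MathematicalPhysics.QuantumFieldTheory.Balaban1983to89.B7Prop2SpecialUnitary (specialUnitaryUnits)
open Literature.MathematicalPhysics.QuantumFieldTheory.Balaban1983to89.B9CoReadingCoords (coordOpK XBK blkBK GcoK DcoK DscoK cdBₗ cdsBₗ)
open Literature.MathematicalPhysics.QuantumFieldTheory.Balaban1983to89.B9CoReadingCoordsHolder (PK wK w₀K)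
open Literature.MathematicalPhysics.QuantumFieldTheory.Balaban1983to89.B9CoReadingCoordsHolderAdm (wKA holderProbesKA)
open Literature.MathematicalPhysics.QuantumFieldTheory.Balaban1983to89.B9CoReadingCoordsHolderS (wS)
open Literature.MathematicalPhysics.QuantumFieldTheory.Balaban1983to89.B9CoReadingCoordsHolderSAdm (wSA holderProbesSA)
open Literature.MathematicalPhysics.QuantumFieldTheory.Balaban1983to89.B9CoReadingCoordsS (XSK blkSK sIK GcoS DcoS DscoS)
open Literature.MathematicalPhysics.QuantumFieldTheory.Balaban1983to89.B9CoReadingCoordsTranspose (TrIdx trBasis)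
open Literature.MathematicalPhysics.QuantumFieldTheory.Balaban1983to89.B9DirSupAtPins (dirSup37_pins dirSup310_pins)
open Literature.MathematicalPhysics.QuantumFieldTheory.Balaban1983to89.B9DirSupAtPins (dirSupSq37_pins)
open Literature.MathematicalPhysics.QuantumFieldTheory.Balaban1983to89.B9DirSupHolderAtPins (dirSupHolder37_of_pins dirSupHolder310_of_pins)
open Literature.MathematicalPhysics.QuantumFieldTheory.Balaban1983to89.B9DirSupSqAtPinsA (dirSupSq310_pins)
open Literature.MathematicalPhysics.QuantumFieldTheory.Balaban1983to89.B9GeoNormsKLevelV1 (geo9K)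
open Literature.MathematicalPhysics.QuantumFieldTheory.Balaban1983to89.B9Ineq349SiteComposite (cdSL cdsSL)
open Literature.MathematicalPhysics.QuantumFieldTheory.Balaban1983to89.B9PinMembersKLevelV1 (MemberY geo9Y bg9Y)
open Literature.MathematicalPhysics.QuantumFieldTheory.Balaban1983to89.B9BackgroundsKLevelV1R (RegFamY bg9YR)
open Literature.MathematicalPhysics.QuantumFieldTheory.Balaban1983to89.B9OpsRTransport (opsRY dirOps37RY ops310RY dirOps310RY holderProbesRY dirTranspose310_iff dirSupHolder310_iff dirSup310_iff dirSupSq37_iff dirSupSq310_iff)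
open Summit.QuantumFields.YangMills.BalabanUVNodes.N06DirKinematicsAtPins (dirSupHolder310_pinsKA)
open Literature.MathematicalPhysics.QuantumFieldTheory.Balaban1983to89.B9RWSums343Holder (HolderProbes)
open Literature.MathematicalPhysics.QuantumFieldTheory.Balaban1983to89.B9RWSums344InputPair (DirSupHolder37 DirSupHolder310)
open Literature.MathematicalPhysics.QuantumFieldTheory.Balaban1983to89.B9RWSums346MixedPair (DirSup37 DirSup310)
open Literature.MathematicalPhysics.QuantumFieldTheory.Balaban1983to89.B9RWSums346SecondDiff (DirOps310 DirTranspose310)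
open Literature.MathematicalPhysics.QuantumFieldTheory.Balaban1983to89.B9RWSums346SecondDiffGp (DirOps37 DirTranspose37)
open Literature.MathematicalPhysics.QuantumFieldTheory.Balaban1983to89.B9Thm310Whole (Ops310)
open Literature.MathematicalPhysics.QuantumFieldTheory.Balaban1983to89.B9Thm310WholeDir (DirSupSq310)
open Literature.MathematicalPhysics.QuantumFieldTheory.Balaban1983to89.B9Thm37Whole (Ops)
open Literature.MathematicalPhysics.QuantumFieldTheory.Balaban1983to89.B9Thm37WholeDir (DirSupSq37)
open Literature.MathematicalPhysics.QuantumFieldTheory.Balaban1983to89.Node00 (SiteY FBondY IBondY SiteOpY SiteParY BondOpY BondParY etaS)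
open Literature.MathematicalPhysics.QuantumFieldTheory.Balaban1983to89.Node00.OpsYDirTranspose (dirTranspose37_memberY dirTranspose310_memberY)
open scoped Matrix.Norms.L2Operator


variable {N : ℕ}
variable {d ℓ : ℕ} {hd : 1 ≤ d + 1} {hL : Odd (ℓ + 1) ∧ 1 < ℓ + 1} {b₀ b₁ : ℝ} {Mstar : ℕ}
variable [∀ x : MemberY d ℓ hd hL b₀ b₁ Mstar, Fintype (geo9Y x).Site]

/-! ## §1 The Hölder-probe direction transfer at dag-n06-w6's CUT probe carriers -/


/-- ★★ **`h36HA` WITH ITS KINEMATIC CONJUNCTS AT THE A-SIDE PINS, R-GENERIC** (module docstring).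
[cite: Balaban1985BackgroundPropagators, p.391 + (3.8) p.392 + (3.42)–(3.45) pp.397–398 + Thm 3.10 p.416 + (3.35)–(3.36) p.396; Balaban1984PropagatorsII, (2.51) p.232] -/
theorem h36HA_of_dir_pinsR {R₁ R₂ : RegFamY d ℓ hd hL b₀ b₁ Mstar (Matrix (Fin N) (Fin N) ℂ)}
    {ιA AA : MemberY d ℓ hd hL b₀ b₁ Mstar → Type}
    (𝔬A : ∀ x : MemberY d ℓ hd hL b₀ b₁ Mstar,
      Ops310 (geo9Y x) (bg9YR (Matrix (Fin N) (Fin N) ℂ) (specialUnitaryUnits (Fin N)) R₁ R₂ x) (XBK (TrIdx N) x.toKIdx) (XBK (TrIdx N) x.toKIdx) (ιA x) (AA x))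
    (𝔡A : ∀ x : MemberY d ℓ hd hL b₀ b₁ Mstar, DirOps310 (𝔬A x) (Fin (d + 1)))
    (𝔭A : ∀ x : MemberY d ℓ hd hL b₀ b₁ Mstar, HolderProbes (geo9Y x) (bg9YR (Matrix (Fin N) (Fin N) ℂ) (specialUnitaryUnits (Fin N)) R₁ R₂ x) (XBK (TrIdx N) x.toKIdx)
      (XBK (TrIdx N) x.toKIdx) (PK (FBondY x.toKIdx) (Fin (d + 1)) (TrIdx N)) (PK (FBondY x.toKIdx) (Fin (d + 1)) (TrIdx N)))
    {bI : ∀ x : MemberY d ℓ hd hL b₀ b₁ Mstar, FBondY x.toKIdx → IBondY x.toKIdx}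
    (GA : ∀ x : MemberY d ℓ hd hL b₀ b₁ Mstar, BondOpY (Matrix (Fin N) (Fin N) ℂ) x.toKIdx)
    (parB : ∀ x : MemberY d ℓ hd hL b₀ b₁ Mstar, BondParY (Matrix (Fin N) (Fin N) ℂ) x.toKIdx)
    (h𝔭A : ∀ x : MemberY d ℓ hd hL b₀ b₁ Mstar,
      𝔭A x = holderProbesKA x.toKIdx (trBasis N) (bg9YR (Matrix (Fin N) (Fin N) ℂ) (specialUnitaryUnits (Fin N)) R₁ R₂ x) (fun U => U) (parB x) (bI x))
    (hblkA : ∀ x : MemberY d ℓ hd hL b₀ b₁ Mstar, (𝔬A x).blk = blkBK x.toKIdx (bI x))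
    (hblkYA : ∀ x : MemberY d ℓ hd hL b₀ b₁ Mstar, (𝔬A x).blkY = blkBK x.toKIdx (bI x))
    (hGcoA : ∀ (x : MemberY d ℓ hd hL b₀ b₁ Mstar) (U : (bg9YR (Matrix (Fin N) (Fin N) ℂ) (specialUnitaryUnits (Fin N)) R₁ R₂ x).Cfg),
      (𝔬A x).G U = GcoK x.toKIdx (trBasis N) (bg9YR (Matrix (Fin N) (Fin N) ℂ) (specialUnitaryUnits (Fin N)) R₁ R₂ x) (fun U => U) (GA x) U)
    (hDcoA : ∀ (x : MemberY d ℓ hd hL b₀ b₁ Mstar) (U : (bg9YR (Matrix (Fin N) (Fin N) ℂ) (specialUnitaryUnits (Fin N)) R₁ R₂ x).Cfg),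
      (𝔬A x).D U = DcoK x.toKIdx (trBasis N) (bg9YR (Matrix (Fin N) (Fin N) ℂ) (specialUnitaryUnits (Fin N)) R₁ R₂ x) (fun U => U) U)
    (hDscoA : ∀ (x : MemberY d ℓ hd hL b₀ b₁ Mstar) (U : (bg9YR (Matrix (Fin N) (Fin N) ℂ) (specialUnitaryUnits (Fin N)) R₁ R₂ x).Cfg),
      (𝔬A x).Dstar U = DscoK x.toKIdx (trBasis N) (bg9YR (Matrix (Fin N) (Fin N) ℂ) (specialUnitaryUnits (Fin N)) R₁ R₂ x) (fun U => U) U)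
    (h𝔡Ad : ∀ (x : MemberY d ℓ hd hL b₀ b₁ Mstar) (U : (bg9YR (Matrix (Fin N) (Fin N) ℂ) (specialUnitaryUnits (Fin N)) R₁ R₂ x).Cfg),
      (𝔡A x).Dd U = fun μ => coordOpK (trBasis N) (fun _ : Fin (d + 1) => cdBₗ x.toKIdx U μ))
    (h𝔡As : ∀ (x : MemberY d ℓ hd hL b₀ b₁ Mstar) (U : (bg9YR (Matrix (Fin N) (Fin N) ℂ) (specialUnitaryUnits (Fin N)) R₁ R₂ x).Cfg),
      (𝔡A x).Dsd U = fun μ => coordOpK (trBasis N) (fun _ : Fin (d + 1) => cdsBₗ x.toKIdx U μ))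
    {M₁ a₁ c R : ℝ} {H : MemberY d ℓ hd hL b₀ b₁ Mstar → Prop}
    {P₁ P₂ P₃ P₄ P₅ P₆ P₇ P₈ : ∀ x : MemberY d ℓ hd hL b₀ b₁ Mstar, (bg9YR (Matrix (Fin N) (Fin N) ℂ) (specialUnitaryUnits (Fin N)) R₁ R₂ x).Cfg → Prop}
    -- RULING-2 (c): node00-def-Y's `dirTranspose310_memberY` reads the (3.35) class of `U` — ONE displayed class-content hypothesis: the R-class lies in MODULE 3's class at the same constant
    (hY335 : ∀ (x : MemberY d ℓ hd hL b₀ b₁ Mstar) (α₀ : ℝ) (U : (bg9YR (Matrix (Fin N) (Fin N) ℂ) (specialUnitaryUnits (Fin N)) R₁ R₂ x).Cfg), (bg9YR (Matrix (Fin N) (Fin N) ℂ) (specialUnitaryUnits (Fin N)) R₁ R₂ x).Reg335 c α₀ U → (bg9Y (Matrix (Fin N) (Fin N) ℂ) (specialUnitaryUnits (Fin N)) x).Reg335 c α₀ U)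
    (h36HA : ∀ x : MemberY d ℓ hd hL b₀ b₁ Mstar, M₁ ≤ (geo9Y x).M → ∀ α₀ : ℝ, 0 < α₀ → c * (geo9Y x).M * α₀ ≤ a₁ →
      ∀ U : (bg9YR (Matrix (Fin N) (Fin N) ℂ) (specialUnitaryUnits (Fin N)) R₁ R₂ x).Cfg, (bg9YR (Matrix (Fin N) (Fin N) ℂ) (specialUnitaryUnits (Fin N)) R₁ R₂ x).Reg335 c α₀ U →
        P₁ x U ∧ P₂ x U ∧ (P₃ x U ∧ P₄ x U) ∧ (P₅ x U ∧ P₆ x U) ∧ (P₇ x U ∧ P₈ x U)) :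
    ∀ x : MemberY d ℓ hd hL b₀ b₁ Mstar, M₁ ≤ (geo9Y x).M → ∀ α₀ : ℝ, 0 < α₀ → c * (geo9Y x).M * α₀ ≤ a₁ →
      ∀ U : (bg9YR (Matrix (Fin N) (Fin N) ℂ) (specialUnitaryUnits (Fin N)) R₁ R₂ x).Cfg, (bg9YR (Matrix (Fin N) (Fin N) ℂ) (specialUnitaryUnits (Fin N)) R₁ R₂ x).Reg335 c α₀ U →
        P₁ x U ∧ P₂ x U ∧ (P₃ x U ∧ P₄ x U ∧ DirTranspose310 (𝔬A x) (𝔡A x) U) ∧ (P₅ x U ∧ P₆ x U ∧ DirSupHolder310 (𝔬A x) (𝔡A x) (𝔭A x) R (H x) U) ∧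
          (P₇ x U ∧ P₈ x U ∧ DirSup310 (𝔬A x) (𝔡A x) R (H x) U) := fun x hM α₀ hα₀ ha U hU => by
  obtain ⟨h₁, h₂, ⟨h₃, h₄⟩, ⟨h₅, h₆⟩, ⟨h₇, h₈⟩⟩ := h36HA x hM α₀ hα₀ ha U hU
  -- the three Ops-typed Y-faces consumed UNCHANGED at node00-def-Y's fieldwise re-typings `ops310RY ∕ dirOps310RY ∕ holderProbesRY`, outputs carried back by their bridges
  have hTr : DirTranspose310 (𝔬A x) (𝔡A x) U := by
    simpa only [dirTranspose310_iff] using dirTranspose310_memberY x (ops310RY (𝔬A x)) (dirOps310RY (𝔡A x)) U (hY335 x α₀ U hU) (h𝔡Ad x U) (h𝔡As x U)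
  have hSH : DirSupHolder310 (𝔬A x) (𝔡A x) (𝔭A x) R (H x) U := by
    simpa only [dirSupHolder310_iff] using dirSupHolder310_pinsKA x (ops310RY (𝔬A x)) (dirOps310RY (𝔡A x)) (holderProbesRY (𝔭A x)) (GA x) (parB x)
      (by rw [h𝔭A x]; rfl) (hblkA x) (hGcoA x U) (hDcoA x U) (h𝔡Ad x U)
  have hS : DirSup310 (𝔬A x) (𝔡A x) R (H x) U := by
    simpa only [dirSup310_iff] using dirSup310_pins x (ops310RY (𝔬A x)) (dirOps310RY (𝔡A x)) (GA x) (hblkA x) (hblkYA x) (hGcoA x U) (hDcoA x U) (hDscoA x U)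
      (h𝔡Ad x U) (h𝔡As x U)
  exact ⟨h₁, h₂, ⟨h₃, h₄, hTr⟩, ⟨h₅, h₆, hSH⟩, ⟨h₇, h₈, hS⟩⟩

/-- ★★ **`h36` WITH `DirSupSq37` AT THE PINS, R-GENERIC** (module docstring). [cite: Balaban1985BackgroundPropagators, (3.42) p.397 + (3.88) p.409, bookkeeping] -/
theorem h36_of_dirSq_pinsR {R₁ R₂ : RegFamY d ℓ hd hL b₀ b₁ Mstar (Matrix (Fin N) (Fin N) ℂ)} {ι : MemberY d ℓ hd hL b₀ b₁ Mstar → Type}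
    (𝔬 : ∀ x : MemberY d ℓ hd hL b₀ b₁ Mstar,
      Ops (geo9Y x) (bg9YR (Matrix (Fin N) (Fin N) ℂ) (specialUnitaryUnits (Fin N)) R₁ R₂ x) (XSK (TrIdx N) x.toKIdx) (XSK (TrIdx N) x.toKIdx) (ι x))
    (𝔡 : ∀ x : MemberY d ℓ hd hL b₀ b₁ Mstar, DirOps37 (𝔬 x) (Fin (d + 1)))
    {bI : ∀ x : MemberY d ℓ hd hL b₀ b₁ Mstar, FBondY x.toKIdx → IBondY x.toKIdx}
    (hblkS : ∀ x : MemberY d ℓ hd hL b₀ b₁ Mstar, (𝔬 x).blk = blkSK x.toKIdx (sIK x.toKIdx (bI x)))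
    (hblkYS : ∀ x : MemberY d ℓ hd hL b₀ b₁ Mstar, (𝔬 x).blkY = blkSK x.toKIdx (sIK x.toKIdx (bI x)))
    (hDS : ∀ (x : MemberY d ℓ hd hL b₀ b₁ Mstar) U, (𝔬 x).D U = DcoS x.toKIdx (trBasis N) (bg9YR (Matrix (Fin N) (Fin N) ℂ) (specialUnitaryUnits (Fin N)) R₁ R₂ x) (fun U => U) U)
    (hDsS : ∀ (x : MemberY d ℓ hd hL b₀ b₁ Mstar) U,
      (𝔬 x).Dstar U = DscoS x.toKIdx (trBasis N) (bg9YR (Matrix (Fin N) (Fin N) ℂ) (specialUnitaryUnits (Fin N)) R₁ R₂ x) (fun U => U) U)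
    (h𝔡d : ∀ (x : MemberY d ℓ hd hL b₀ b₁ Mstar) (U : (bg9YR (Matrix (Fin N) (Fin N) ℂ) (specialUnitaryUnits (Fin N)) R₁ R₂ x).Cfg),
      (𝔡 x).Dd U = fun μ => (etaS x.toKIdx)⁻¹ • coordOpK (trBasis N) (fun _ : Fin (d + 1) => (cdSL x.toKIdx U μ).restrictScalars ℝ))
    (h𝔡s : ∀ (x : MemberY d ℓ hd hL b₀ b₁ Mstar) (U : (bg9YR (Matrix (Fin N) (Fin N) ℂ) (specialUnitaryUnits (Fin N)) R₁ R₂ x).Cfg),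
      (𝔡 x).Dsd U = fun μ => (etaS x.toKIdx)⁻¹ • coordOpK (trBasis N) (fun _ : Fin (d + 1) => (cdsSL x.toKIdx U μ).restrictScalars ℝ))
    (hGsq : ∀ (x : MemberY d ℓ hd hL b₀ b₁ Mstar) (U : (bg9YR (Matrix (Fin N) (Fin N) ℂ) (specialUnitaryUnits (Fin N)) R₁ R₂ x).Cfg) (j : ι x),
      ∃ (r : ℝ) (G : (SiteY x.toKIdx → Matrix (Fin N) (Fin N) ℂ) →ₗ[ℝ] (SiteY x.toKIdx → Matrix (Fin N) (Fin N) ℂ)),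
        (𝔬 x).Gsq U j = r • coordOpK (trBasis N) (fun _ : Fin (d + 1) => G))
    {M₁ a₁ c R : ℝ} {H : MemberY d ℓ hd hL b₀ b₁ Mstar → Prop}
    {P Q : ∀ x : MemberY d ℓ hd hL b₀ b₁ Mstar, (bg9YR (Matrix (Fin N) (Fin N) ℂ) (specialUnitaryUnits (Fin N)) R₁ R₂ x).Cfg → Prop}
    (h36 : ∀ x : MemberY d ℓ hd hL b₀ b₁ Mstar, M₁ ≤ (geo9Y x).M → ∀ α₀ : ℝ, 0 < α₀ → c * (geo9Y x).M * α₀ ≤ a₁ →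
      ∀ U : (bg9YR (Matrix (Fin N) (Fin N) ℂ) (specialUnitaryUnits (Fin N)) R₁ R₂ x).Cfg, (bg9YR (Matrix (Fin N) (Fin N) ℂ) (specialUnitaryUnits (Fin N)) R₁ R₂ x).Reg335 c α₀ U → P x U ∧ Q x U) :
    ∀ x : MemberY d ℓ hd hL b₀ b₁ Mstar, M₁ ≤ (geo9Y x).M → ∀ α₀ : ℝ, 0 < α₀ → c * (geo9Y x).M * α₀ ≤ a₁ →
      ∀ U : (bg9YR (Matrix (Fin N) (Fin N) ℂ) (specialUnitaryUnits (Fin N)) R₁ R₂ x).Cfg, (bg9YR (Matrix (Fin N) (Fin N) ℂ) (specialUnitaryUnits (Fin N)) R₁ R₂ x).Reg335 c α₀ U → P x U ∧ DirSupSq37 (𝔬 x) (𝔡 x) R (H x) U ∧ Q x U :=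
  fun x hM α₀ hα₀ ha U hU =>
    ⟨(h36 x hM α₀ hα₀ ha U hU).1,
      by simpa only [dirSupSq37_iff] using dirSupSq37_pins x (opsRY (𝔬 x)) (dirOps37RY (𝔡 x)) (hblkS x) (hblkYS x) (hDS x U) (hDsS x U) (h𝔡d x U) (h𝔡s x U) (hGsq x U),
      (h36 x hM α₀ hα₀ ha U hU).2⟩

/-- ★★ **`h36A` WITH `DirSupSq310` AT THE PINS, R-GENERIC** (module docstring). [cite: Balaban1985BackgroundPropagators, (3.42) p.397 + Thm 3.10 p.416, bookkeeping] -/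
theorem h36A_of_dirSq_pinsR {R₁ R₂ : RegFamY d ℓ hd hL b₀ b₁ Mstar (Matrix (Fin N) (Fin N) ℂ)} {ιA AA : MemberY d ℓ hd hL b₀ b₁ Mstar → Type}
    (𝔬A : ∀ x : MemberY d ℓ hd hL b₀ b₁ Mstar,
      Ops310 (geo9Y x) (bg9YR (Matrix (Fin N) (Fin N) ℂ) (specialUnitaryUnits (Fin N)) R₁ R₂ x) (XBK (TrIdx N) x.toKIdx) (XBK (TrIdx N) x.toKIdx) (ιA x) (AA x))
    (𝔡A : ∀ x : MemberY d ℓ hd hL b₀ b₁ Mstar, DirOps310 (𝔬A x) (Fin (d + 1)))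
    {bI : ∀ x : MemberY d ℓ hd hL b₀ b₁ Mstar, FBondY x.toKIdx → IBondY x.toKIdx}
    (hblkA : ∀ x : MemberY d ℓ hd hL b₀ b₁ Mstar, (𝔬A x).blk = blkBK x.toKIdx (bI x)) (hblkYA : ∀ x : MemberY d ℓ hd hL b₀ b₁ Mstar, (𝔬A x).blkY = blkBK x.toKIdx (bI x))
    (hDcoA : ∀ (x : MemberY d ℓ hd hL b₀ b₁ Mstar) (U : (bg9YR (Matrix (Fin N) (Fin N) ℂ) (specialUnitaryUnits (Fin N)) R₁ R₂ x).Cfg), (𝔬A x).D U = DcoK x.toKIdx (trBasis N) (bg9YR (Matrix (Fin N) (Fin N) ℂ) (specialUnitaryUnits (Fin N)) R₁ R₂ x) (fun U => U) U)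
    (hDscoA : ∀ (x : MemberY d ℓ hd hL b₀ b₁ Mstar) (U : (bg9YR (Matrix (Fin N) (Fin N) ℂ) (specialUnitaryUnits (Fin N)) R₁ R₂ x).Cfg),
      (𝔬A x).Dstar U = DscoK x.toKIdx (trBasis N) (bg9YR (Matrix (Fin N) (Fin N) ℂ) (specialUnitaryUnits (Fin N)) R₁ R₂ x) (fun U => U) U)
    (h𝔡Ad : ∀ (x : MemberY d ℓ hd hL b₀ b₁ Mstar) (U : (bg9YR (Matrix (Fin N) (Fin N) ℂ) (specialUnitaryUnits (Fin N)) R₁ R₂ x).Cfg), (𝔡A x).Dd U = fun μ => coordOpK (trBasis N) (fun _ : Fin (d + 1) => cdBₗ x.toKIdx U μ))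
    (h𝔡As : ∀ (x : MemberY d ℓ hd hL b₀ b₁ Mstar) (U : (bg9YR (Matrix (Fin N) (Fin N) ℂ) (specialUnitaryUnits (Fin N)) R₁ R₂ x).Cfg), (𝔡A x).Dsd U = fun μ => coordOpK (trBasis N) (fun _ : Fin (d + 1) => cdsBₗ x.toKIdx U μ))
    (hGsqS : ∀ (x : MemberY d ℓ hd hL b₀ b₁ Mstar) (U : (bg9YR (Matrix (Fin N) (Fin N) ℂ) (specialUnitaryUnits (Fin N)) R₁ R₂ x).Cfg) (j : ιA x),
      ∃ (r : ℝ) (G : (FBondY x.toKIdx → Matrix (Fin N) (Fin N) ℂ) →ₗ[ℝ] (FBondY x.toKIdx → Matrix (Fin N) (Fin N) ℂ)),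
        (𝔬A x).Gsq U j = r • coordOpK (trBasis N) (fun _ : Fin (d + 1) => G))
    {M₁ a₁ c R : ℝ} {H : MemberY d ℓ hd hL b₀ b₁ Mstar → Prop}
    {P Q S : ∀ x : MemberY d ℓ hd hL b₀ b₁ Mstar, (bg9YR (Matrix (Fin N) (Fin N) ℂ) (specialUnitaryUnits (Fin N)) R₁ R₂ x).Cfg → Prop}
    (h36A : ∀ x : MemberY d ℓ hd hL b₀ b₁ Mstar, M₁ ≤ (geo9Y x).M → ∀ α₀ : ℝ, 0 < α₀ → c * (geo9Y x).M * α₀ ≤ a₁ →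
      ∀ U : (bg9YR (Matrix (Fin N) (Fin N) ℂ) (specialUnitaryUnits (Fin N)) R₁ R₂ x).Cfg, (bg9YR (Matrix (Fin N) (Fin N) ℂ) (specialUnitaryUnits (Fin N)) R₁ R₂ x).Reg335 c α₀ U → P x U ∧ Q x U ∧ S x U) :
    ∀ x : MemberY d ℓ hd hL b₀ b₁ Mstar, M₁ ≤ (geo9Y x).M → ∀ α₀ : ℝ, 0 < α₀ → c * (geo9Y x).M * α₀ ≤ a₁ →
      ∀ U : (bg9YR (Matrix (Fin N) (Fin N) ℂ) (specialUnitaryUnits (Fin N)) R₁ R₂ x).Cfg, (bg9YR (Matrix (Fin N) (Fin N) ℂ) (specialUnitaryUnits (Fin N)) R₁ R₂ x).Reg335 c α₀ U → P x U ∧ Q x U ∧ DirSupSq310 (𝔬A x) (𝔡A x) R (H x) U ∧ S x U :=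
  fun x hM α₀ hα₀ ha U hU =>
    ⟨(h36A x hM α₀ hα₀ ha U hU).1, (h36A x hM α₀ hα₀ ha U hU).2.1,
      by simpa only [dirSupSq310_iff] using
        dirSupSq310_pins x (ops310RY (𝔬A x)) (dirOps310RY (𝔡A x)) (hblkA x) (hblkYA x) (hDcoA x U) (hDscoA x U) (h𝔡Ad x U) (h𝔡As x U) (hGsqS x U),
      (h36A x hM α₀ hα₀ ha U hU).2.2⟩

end Summit.QuantumFields.YangMills.BalabanUVNodes.N06DirKinematicsAtPinsR

end
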